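import Summits.AtomisticToContinuum.HydrodynamicLimit.Theorems.BoxDissipativeWeakStrongFluxClosureOfParts
import Summits.AtomisticToContinuum.HydrodynamicLimit.Theorems.BoxDissipativeWeakStrongFluxClosureCollisionalVirialTight
import Summits.AtomisticToContinuum.HydrodynamicLimit.Theorems.BoxDissipativeWeakStrongLocalGibbsFineScaleStaticsMain
import HarnessLib

/-!
# Crux `FluxClosure` (stmt-AtomisticToContinuum-9902, route BoxDissipativeWeakStrong), line `registered`,
# rung 0 (global equilibrium), piece E4: the convective term closes in `L¹(P_N)`

Support file (`--supports stmt-AtomisticToContinuum-9902`) of the lead's RUNG-0 PROGRAMME (the crux in GLOBAL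
EQUILIBRIUM: constant profiles, law `P_N = localGibbsLaw σ (fun _ => a) (fun _ => u) (fun _ => θ) N (Φ N)`).
Registered sub-goal `homogeneous_convectiveTerm` (E4): GIVEN uniform-in-time fine-scale bounds
`∫⁻ z∫⁻ₓ|ρ̂ − c₀| ≤ δ_N`, `∫⁻ z∫⁻ₓ‖m̂ − c₀u‖ ≤ δ_N`, `∫⁻ z∫⁻ₓ|Ê − E₀| ≤ δ_N` (`E₀ = totalEnergyDensity c₀ u θ`, `δ_N → 0`,
`c₀ > 0`; box fields of `Φ_t z` at the cube kernel of side `ℓ_N`), the time-integrated CONVECTIVE term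
`∫_0^τ∫ Σ_ij (m̂_im̂_j/ρ̂) ∂_jw_i` converges in `L¹(P_N)` to its constant-field value `∫_0^τ∫ Σ_ij c₀u_iu_j ∂_jw_i`.
No uniform integrability is needed, only a POINTWISE LEMMA (`E4_exists_coeff`): for `r, E ≥ 0`, `‖m‖² ≤ 2rE`,
`|m_im_j/r − c₀u_iu_j| ≤ A(c₀, ‖u‖, E₀) (|r − c₀| + ‖m − c₀u‖ + |E − E₀|)` — with `d = m − ru`,
`m_im_j/r − c₀u_iu_j = (r − c₀)u_iu_j + u_id_j + d_iu_j + d_id_j/r`, `‖d‖²/r ≤ ‖d‖` if `‖d‖ ≤ r`, else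
`‖d‖²/r ≤ 4E + 2r‖u‖²` and `1 ≤ (2/c₀)(|r − c₀| + ‖d‖)`. Plumbing: `P_N`-a.e. datum is good; along a good orbit both
space–time integrals exist (`FluxClosureB4.integrableOn_Ioc_integral`), so `ofReal |∫∫F_N − ∫∫F_∞| ≤ ∫⁻ₜ∫⁻ₓ ofReal|F_N − F_∞|
≤ 9CA ∫⁻ₜ(∫⁻ₓ|ρ̂ − c₀| + ∫⁻ₓ‖m̂ − c₀u‖ + ∫⁻ₓ|Ê − E₀|)` (`C = sup|∂_jw_i|` on `[0,τ] × 𝕋³`); Tonelli in `(z, t)` (flow jointly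
measurable on `good × ℝ`; `P_N` s-finite, carried by the good set) and the hypotheses give `≤ 27 C A τ δ_N → 0`.
No definitions. References: H. Spohn, *Large Scale Dynamics of Interacting Particles* (1991), Part I §3.2–3.3.
-/
noncomputable section

namespace Summit.AtomisticToContinuum.HydrodynamicLimit.Theorems
namespace FluxClosureEq
namespace E4

open scoped BigOperators Topology Classical MeasureTheory ProbabilityTheory InnerProductSpace ENNReal
open Filter Set Function MeasureTheory
open Literature.MathematicalPhysics.KineticTheory Literature.Analysis.FluidPDE Literature.Analysis.FunctionSpaces
open Summit.AtomisticToContinuum.HydrodynamicLimit.Theses.BoxDissipativeWeakStrong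
open Summit.AtomisticToContinuum.HydrodynamicLimit.Theorems.EntropyClockDock (ae_mem_good_localGibbsLaw)

/-- **Pointwise lemma.** For `c₀ > 0`, `u : V3`, `E₀ : ℝ` there is `A ≥ 0` with
`|m_im_j/r − c₀u_iu_j| ≤ A (|r − c₀| + ‖m − c₀u‖ + |E − E₀|)` whenever `0 ≤ r`, `0 ≤ E`, `‖m‖² ≤ 2rE`
(real division, `x/0 = 0`). [folklore] -/
theorem E4_exists_coeff {c₀ : ℝ} (hc₀ : 0 < c₀) (u : V3) (E₀ : ℝ) :
    ∃ A : ℝ, 0 ≤ A ∧ ∀ (r E : ℝ) (m : V3), 0 ≤ r → 0 ≤ E → ‖m‖ ^ 2 ≤ 2 * r * E → ∀ i j : Fin 3,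
      |m i * m j / r - c₀ * (u i * u j)| ≤ A * (|r - c₀| + ‖m - c₀ • u‖ + |E - E₀|) := by
  set U : ℝ := ‖u‖ with hU
  set h : ℝ := |4 * E₀ + 2 * c₀ * U ^ 2| with hh
  set k : ℝ := 2 / c₀ with hk
  have hU0 : 0 ≤ U := norm_nonneg _
  have hh0 : 0 ≤ h := abs_nonneg _
  have hk0 : 0 ≤ k := by positivity
  have hhk : 0 ≤ h * k := mul_nonneg hh0 hk0
  refine ⟨5 * U ^ 2 + 3 * U + h * k * (2 + U) + 5, by positivity, ?_⟩
  intro r E m hr hE hCS i j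
  have hul : ∀ l, |u l| ≤ U := fun l => by simpa using PiLp.norm_apply_le u l
  have hD₁ : 0 ≤ |r - c₀| := abs_nonneg _
  have hD₂ : 0 ≤ ‖m - c₀ • u‖ := norm_nonneg _
  have hD₃ : 0 ≤ |E - E₀| := abs_nonneg _
  have huu : |u i| * |u j| ≤ U ^ 2 := by rw [sq]; exact mul_le_mul (hul i) (hul j) (abs_nonneg _) hU0
  rcases hr.eq_or_lt with h0 | hr'
  · -- empty box: `r = 0`, the left side is `c₀ |u_i u_j| ≤ c₀ U²`, and `|r - c₀| = c₀`
    have hD : |r - c₀| = c₀ := by rw [← h0, zero_sub, abs_neg, abs_of_pos hc₀]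
    calc |m i * m j / r - c₀ * (u i * u j)| = c₀ * (|u i| * |u j|) := by
          rw [← h0, div_zero, zero_sub, abs_neg, abs_mul, abs_mul, abs_of_pos hc₀]
      _ ≤ (5 * U ^ 2 + 3 * U + h * k * (2 + U) + 5) * |r - c₀| := by
          rw [hD, mul_comm]
          refine mul_le_mul_of_nonneg_right (huu.trans ?_) hc₀.le
          nlinarith [mul_nonneg hhk (by positivity : (0 : ℝ) ≤ 2 + U)]
      _ ≤ _ := mul_le_mul_of_nonneg_left (by linarith) (by positivity)
  · set d : V3 := m - r • u with hd
    have hdl : ∀ l, |d l| ≤ ‖d‖ := fun l => by simpa using PiLp.norm_apply_le d l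
    have hml : ∀ l, m l = r * u l + d l := fun l => by
      simp only [hd, PiLp.sub_apply, PiLp.smul_apply, smul_eq_mul]; ring
    have key : m i * m j / r - c₀ * (u i * u j) =
        (r - c₀) * (u i * u j) + u i * d j + d i * u j + d i * d j / r := by
      rw [hml i, hml j]; field_simp; ring
    have hdn : ‖d‖ ≤ ‖m - c₀ • u‖ + U * |r - c₀| := by
      have e : d = (m - c₀ • u) + (c₀ - r) • u := by rw [hd, sub_smul]; abel
      rw [e]
      refine (norm_add_le _ _).trans ?_
      rw [norm_smul, Real.norm_eq_abs, abs_sub_comm, mul_comm]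
    have hdsq : ‖d‖ ^ 2 / r ≤ ‖d‖ + (4 * |E - E₀| + 2 * U ^ 2 * |r - c₀|) + h * (k * |r - c₀| + k * ‖d‖) := by
      rcases le_or_gt ‖d‖ r with hle | hlt
      · have h1 : ‖d‖ ^ 2 / r ≤ ‖d‖ := by
          rw [div_le_iff₀ hr', sq]; exact mul_le_mul_of_nonneg_left hle (norm_nonneg _)
        have h2 : 0 ≤ (4 * |E - E₀| + 2 * U ^ 2 * |r - c₀|) + h * (k * |r - c₀| + k * ‖d‖) := by positivity
        linarith
      · have h1 : ‖d‖ ≤ ‖m‖ + r * U := by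
          rw [hd]; refine (norm_sub_le _ _).trans ?_; rw [norm_smul, Real.norm_eq_abs, abs_of_pos hr']
        have h2 : ‖d‖ ^ 2 / r ≤ 4 * E + 2 * r * U ^ 2 := by
          rw [div_le_iff₀ hr']
          have hsq : ‖d‖ ^ 2 ≤ (‖m‖ + r * U) ^ 2 := pow_le_pow_left₀ (norm_nonneg _) h1 2
          nlinarith [hsq, hCS, sq_nonneg (‖m‖ - r * U)]
        have h6 : ∀ {x : ℝ}, c₀ / 2 ≤ x → 1 ≤ k * x := fun hx =>
          calc (1 : ℝ) = 2 / c₀ * (c₀ / 2) := by field_simp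
            _ ≤ _ := mul_le_mul_of_nonneg_left hx hk0
        have h3 : 1 ≤ k * |r - c₀| + k * ‖d‖ := by
          rcases lt_or_ge r (c₀ / 2) with hrc | hrc
          · have h5 : c₀ / 2 ≤ |r - c₀| := by rw [abs_sub_comm]; linarith [le_abs_self (c₀ - r)]
            linarith [h6 h5, mul_nonneg hk0 (norm_nonneg d)]
          · linarith [h6 (hrc.trans hlt.le), mul_nonneg hk0 hD₁]
        have h4 : 4 * E + 2 * r * U ^ 2 ≤ h + (4 * |E - E₀| + 2 * U ^ 2 * |r - c₀|) := by
          have := le_abs_self (4 * E₀ + 2 * c₀ * U ^ 2)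
          have := le_abs_self (E - E₀)
          have := mul_le_mul_of_nonneg_left (le_abs_self (r - c₀)) (by positivity : (0 : ℝ) ≤ 2 * U ^ 2)
          linarith
        have h5 : h ≤ h * (k * |r - c₀| + k * ‖d‖) := le_mul_of_one_le_right hh0 h3
        linarith [norm_nonneg d]
    rw [key]
    have t1 : |(r - c₀) * (u i * u j)| ≤ |r - c₀| * U ^ 2 := by rw [abs_mul, abs_mul]; exact mul_le_mul_of_nonneg_left huu hD₁
    have t2 : |u i * d j| ≤ U * ‖d‖ := by rw [abs_mul]; exact mul_le_mul (hul i) (hdl j) (abs_nonneg _) hU0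
    have t3 : |d i * u j| ≤ ‖d‖ * U := by rw [abs_mul]; exact mul_le_mul (hdl i) (hul j) (abs_nonneg _) (norm_nonneg _)
    have t4 : |d i * d j / r| ≤ ‖d‖ ^ 2 / r := by
      rw [abs_div, abs_mul, abs_of_pos hr', sq]
      exact div_le_div_of_nonneg_right (mul_le_mul (hdl i) (hdl j) (abs_nonneg _) (norm_nonneg _)) hr'.le
    calc |(r - c₀) * (u i * u j) + u i * d j + d i * u j + d i * d j / r|
        ≤ |(r - c₀) * (u i * u j)| + |u i * d j| + |d i * u j| + |d i * d j / r| :=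
          (abs_add_le _ _).trans (add_le_add (abs_add_three _ _ _) le_rfl)
      _ ≤ |r - c₀| * U ^ 2 + U * ‖d‖ + ‖d‖ * U +
            (‖d‖ + (4 * |E - E₀| + 2 * U ^ 2 * |r - c₀|) + h * (k * |r - c₀| + k * ‖d‖)) :=
          add_le_add (add_le_add (add_le_add t1 t2) t3) (t4.trans hdsq)
      _ = |r - c₀| * (3 * U ^ 2 + h * k) + ‖d‖ * (2 * U + 1 + h * k) + 4 * |E - E₀| := by ring
      _ ≤ |r - c₀| * (3 * U ^ 2 + h * k) + (‖m - c₀ • u‖ + U * |r - c₀|) * (2 * U + 1 + h * k) +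
            4 * |E - E₀| := by gcongr
      _ = (5 * U ^ 2 + U + h * k * (1 + U)) * |r - c₀| + (2 * U + 1 + h * k) * ‖m - c₀ • u‖ +
            4 * |E - E₀| := by ring
      _ ≤ (5 * U ^ 2 + 3 * U + h * k * (2 + U) + 5) * |r - c₀| +
            (5 * U ^ 2 + 3 * U + h * k * (2 + U) + 5) * ‖m - c₀ • u‖ +
            (5 * U ^ 2 + 3 * U + h * k * (2 + U) + 5) * |E - E₀| := by
          refine add_le_add_three (mul_le_mul_of_nonneg_right ?_ hD₁) (mul_le_mul_of_nonneg_right ?_ hD₂)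
            (mul_le_mul_of_nonneg_right ?_ hD₃)
          · nlinarith [mul_nonneg hhk hU0]
          · nlinarith [mul_nonneg hhk hU0, sq_nonneg U]
          · nlinarith [mul_nonneg hhk (by positivity : (0 : ℝ) ≤ 2 + U), sq_nonneg U]
      _ = _ := by ring

/-- The convective integrand against a bounded matrix `g` (`|g_ij| ≤ C`): with `A` as in `E4_exists_coeff`,
`|Σ_ij (m_im_j/r) g_ij − Σ_ij ((c₀u)_i(c₀u)_j/c₀) g_ij| ≤ 9 C A (|r − c₀| + ‖m − c₀u‖ + |E − E₀|)`. [folklore] -/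
theorem E4_abs_sum_sub_sum_le {A c₀ C E₀ : ℝ} {u : V3} (hc₀ : 0 < c₀) (hA0 : 0 ≤ A)
    (hA : ∀ (r E : ℝ) (m : V3), 0 ≤ r → 0 ≤ E → ‖m‖ ^ 2 ≤ 2 * r * E → ∀ i j : Fin 3,
      |m i * m j / r - c₀ * (u i * u j)| ≤ A * (|r - c₀| + ‖m - c₀ • u‖ + |E - E₀|))
    {r E : ℝ} {m : V3} (hr : 0 ≤ r) (hE : 0 ≤ E) (hCS : ‖m‖ ^ 2 ≤ 2 * r * E)
    {g : Fin 3 → Fin 3 → ℝ} (hg : ∀ i j, |g i j| ≤ C) :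
    |(∑ i, ∑ j, m i * m j / r * g i j) - ∑ i, ∑ j, (c₀ • u) i * (c₀ • u) j / c₀ * g i j| ≤
      9 * C * A * (|r - c₀| + ‖m - c₀ • u‖ + |E - E₀|) := by
  have hcu : ∀ i j, (c₀ • u) i * (c₀ • u) j / c₀ = c₀ * (u i * u j) := fun i j => by
    rw [PiLp.smul_apply, PiLp.smul_apply, smul_eq_mul, smul_eq_mul]; field_simp
  have hL : 0 ≤ A * (|r - c₀| + ‖m - c₀ • u‖ + |E - E₀|) := by positivity
  rw [← Finset.sum_sub_distrib]
  simp_rw [← Finset.sum_sub_distrib, ← sub_mul, hcu]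
  calc |∑ i, ∑ j, (m i * m j / r - c₀ * (u i * u j)) * g i j|
      ≤ ∑ i, ∑ j, |(m i * m j / r - c₀ * (u i * u j)) * g i j| :=
        (Finset.abs_sum_le_sum_abs _ _).trans (Finset.sum_le_sum fun i _ => Finset.abs_sum_le_sum_abs _ _)
    _ ≤ ∑ _i : Fin 3, ∑ _j : Fin 3, A * (|r - c₀| + ‖m - c₀ • u‖ + |E - E₀|) * C := by
        refine Finset.sum_le_sum fun i _ => Finset.sum_le_sum fun j _ => ?_
        rw [abs_mul]
        exact mul_le_mul (hA r E m hr hE hCS i j) (hg i j) (abs_nonneg _) hL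
    _ = 9 * C * A * (|r - c₀| + ‖m - c₀ • u‖ + |E - E₀|) := by
        simp only [Finset.sum_const, Finset.card_univ, Fintype.card_fin, nsmul_eq_mul]; push_cast; ring

/-- The hypotheses of the pointwise lemma hold for box fields with a weight `χ ≥ 0`:
`0 ≤ ρ̂`, `0 ≤ Ê`, `‖m̂‖² ≤ 2ρ̂Ê` (Cauchy–Schwarz, `DeviatoricStressClosure.norm_sq_momentum_le`). [folklore] -/
theorem E4_boxFields_hyp {n : ℕ} (c : Config n (Fin 3) T3) {χ : T3 → ℝ} (hχ : ∀ y, 0 ≤ χ y) :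
    0 ≤ empiricalDensityField c χ ∧ 0 ≤ empiricalEnergyField c χ ∧
      ‖empiricalMomentumField c χ‖ ^ 2 ≤ 2 * empiricalDensityField c χ * empiricalEnergyField c χ := by
  have h := FluxClosureK.weight_eq_translate χ 0
  have hR : empiricalDensityField c χ = empiricalDensityField c (fun y => (fun v => χ (0 - v)) (0 - y)) := by rw [← h]
  have hM : empiricalMomentumField c χ = empiricalMomentumField c (fun y => (fun v => χ (0 - v)) (0 - y)) := by rw [← h]
  have hE : empiricalEnergyField c χ = empiricalEnergyField c (fun y => (fun v => χ (0 - v)) (0 - y)) := by rw [← h]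
  obtain ⟨hR0, hE0, -, -⟩ :=
    DeviatoricStressClosure.abs_reynolds_le_and_abs_pressure_le c 0 (k := fun v => χ (0 - v)) (fun y => hχ _) hR hM hE
  exact ⟨hR0, hE0, DeviatoricStressClosure.norm_sq_momentum_le c 0 (k := fun v => χ (0 - v)) (fun y => hχ _) hR hM hE⟩

/-- The three deviation integrands `ofReal |ρ̂ − c₀|`, `ofReal ‖m̂ − c₀u‖`, `ofReal |Ê − E₀|` are jointly measurable in
(configuration, point) for a jointly measurable kernel (`FluxClosureB5.measurable_*`). [folklore] -/
theorem E4_measurable_dev {n : ℕ} {K : T3 → T3 → ℝ} (hK : Measurable fun p : T3 × T3 => K p.1 p.2)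
    (c₀ E₀ : ℝ) (u : V3) :
    (Measurable fun p : Config n (Fin 3) T3 × T3 => ENNReal.ofReal |empiricalDensityField p.1 (K p.2) - c₀|) ∧
    (Measurable fun p : Config n (Fin 3) T3 × T3 => ENNReal.ofReal ‖empiricalMomentumField p.1 (K p.2) - c₀ • u‖) ∧
    (Measurable fun p : Config n (Fin 3) T3 × T3 => ENNReal.ofReal |empiricalEnergyField p.1 (K p.2) - E₀|) :=
  ⟨(continuous_abs.measurable.comp ((FluxClosureB5.measurable_density hK).sub_const c₀)).ennreal_ofReal,
    ((FluxClosureB5.measurable_momentum hK).sub_const (c₀ • u)).norm.ennreal_ofReal,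
    (continuous_abs.measurable.comp ((FluxClosureB5.measurable_energy hK).sub_const E₀)).ennreal_ofReal⟩

/-- **Plumbing in `(t, x)`.** If `F`, `F'` agree on the slab `[0,T) × 𝕋³` with jointly measurable `G`, `G'`
bounded on `[0,τ] × 𝕋³` (`τ < T`), then both iterated integrals over `(0,τ] × 𝕋³` exist and
`ofReal |∫∫F − ∫∫F'| ≤ ∫⁻ₜ∫⁻ₓ b` for every pointwise bound `ofReal |F − F'| ≤ b` on `(0,τ] × 𝕋³`. [folklore] -/
theorem E4_ofReal_abs_sub_le {F F' : ℝ → T3 → ℝ} {G G' : ℝ × T3 → ℝ} {τ T C C' : ℝ} (hτT : τ < T)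
    (hG : Measurable G) (hG' : Measurable G') (hFG : ∀ t ∈ Ico 0 T, ∀ x, F t x = G (t, x))
    (hFG' : ∀ t ∈ Ico 0 T, ∀ x, F' t x = G' (t, x)) (hC : ∀ p : ℝ × T3, p.1 ∈ Icc 0 τ → |G p| ≤ C)
    (hC' : ∀ p : ℝ × T3, p.1 ∈ Icc 0 τ → |G' p| ≤ C') {b : ℝ → T3 → ℝ≥0∞}
    (hb : ∀ t ∈ Ioc 0 τ, ∀ x, ENNReal.ofReal |F t x - F' t x| ≤ b t x) :
    ENNReal.ofReal |(∫ t in Ioc 0 τ, ∫ x, F t x) - ∫ t in Ioc 0 τ, ∫ x, F' t x| ≤ ∫⁻ t in Ioc 0 τ, ∫⁻ x, b t x := by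
  have hI := FluxClosureB4.integrableOn_Ioc_integral hτT hG hFG hC
  have hI' := FluxClosureB4.integrableOn_Ioc_integral hτT hG' hFG' hC'
  rw [← integral_sub hI hI', ← Real.enorm_eq_ofReal_abs]
  refine (enorm_integral_le_lintegral_enorm _).trans (setLIntegral_mono' measurableSet_Ioc fun t ht => ?_)
  have htT : t ∈ Ico 0 T := ⟨ht.1.le, lt_of_le_of_lt ht.2 hτT⟩
  have hint : ∀ {F₀ : ℝ → T3 → ℝ} {G₀ : ℝ × T3 → ℝ} {C₀ : ℝ}, Measurable G₀ → (∀ t ∈ Ico 0 T, ∀ x, F₀ t x = G₀ (t, x)) →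
      (∀ p : ℝ × T3, p.1 ∈ Icc 0 τ → |G₀ p| ≤ C₀) → Integrable (F₀ t) := by
    intro F₀ G₀ C₀ hG₀ hFG₀ hC₀
    have he : F₀ t = fun x => G₀ (t, x) := funext (hFG₀ t htT)
    rw [he]
    exact (integrable_const C₀).mono' (hG₀.comp (measurable_const.prodMk measurable_id)).aestronglyMeasurable
      (ae_of_all _ fun x => by rw [Real.norm_eq_abs]; exact hC₀ (t, x) ⟨ht.1.le, ht.2⟩)
  rw [← integral_sub (hint hG hFG hC) (hint hG' hFG' hC')]
  exact (enorm_integral_le_lintegral_enorm _).trans (lintegral_mono fun x => by rw [Real.enorm_eq_ofReal_abs]; exact hb t ht x)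

/-- **A.e.-measurability on `phase space × time`.** For a hard-sphere flow `Ψ` on `𝕋³`, a measurable `g` on phase
space, a law `μ` carried by the good set and an s-finite `ν` on `ℝ`, `(z, t) ↦ g (Ψ_t z)` is `μ ⊗ ν`-a.e. measurable
(the flow is jointly measurable on `good × ℝ`, `HardSphereFlow.measurable_flow_prod_torus`; modify off the good set).
[folklore] -/
theorem E4_aemeasurable_comp_flow_prod {n : ℕ} {ε : ℝ} (Ψ : HardSphereFlow (Torus.geometry (Fin 3)) ε n)
    {g : Config n (Fin 3) T3 → ℝ≥0∞} (hg : Measurable g) {μ : Measure (Config n (Fin 3) T3)}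
    (hμ : μ Ψ.goodᶜ = 0) (ν : Measure ℝ) [SFinite ν] :
    AEMeasurable (uncurry fun (z : Config n (Fin 3) T3) (t : ℝ) => g (Ψ.flow t z)) (μ.prod ν) := by
  set s : Set (Config n (Fin 3) T3 × ℝ) := Prod.fst ⁻¹' Ψ.good with hs_def
  have hs : MeasurableSet s := measurable_fst Ψ.measurableSet_good
  have h1 : Measurable fun p : s => ((⟨p.1.1, p.2⟩ : Ψ.good), p.1.2) :=
    (measurable_subtype_coe.fst.subtype_mk).prodMk measurable_subtype_coe.snd
  have hf : Measurable fun p : s => g (Ψ.flow p.1.2 p.1.1) := hg.comp (Ψ.measurable_flow_prod_torus.comp h1)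
  refine ⟨fun p => if hp : p ∈ s then g (Ψ.flow p.2 p.1) else 0, ?_, ?_⟩
  · exact Measurable.dite (f := fun p : s => g (Ψ.flow p.1.2 p.1.1)) hf (g := fun _ => 0) measurable_const hs
  · have hae : ∀ᵐ p ∂(μ.prod ν), p ∈ s := by
      rw [ae_iff]
      have e : {p : Config n (Fin 3) T3 × ℝ | ¬p ∈ s} = Ψ.goodᶜ ×ˢ (univ : Set ℝ) := by
        ext p; simp [hs_def]
      rw [e, Measure.prod_prod, hμ, zero_mul]
    filter_upwards [hae] with p hp
    simp only [uncurry, dif_pos hp]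

/-- **Pathwise estimate.** Along a measurable configuration path `γ` with speeds `≤ V`, for a jointly measurable
kernel `0 ≤ k ≤ κ`, `τ ∈ [0,T)`, `w` smooth on `[0,T) × 𝕋³` with `|∂_jw_i| ≤ C` on `[0,τ] × 𝕋³`, `c₀ > 0` and `A` as in
`E4_exists_coeff`: `ofReal |∫_0^τ∫ Σ_ij (m̂_im̂_j/ρ̂) ∂_jw_i − ∫_0^τ∫ Σ_ij ((c₀u)_i(c₀u)_j/c₀) ∂_jw_i|
≤ ∫⁻_{(0,τ]} 9CA (∫⁻ₓ|ρ̂ − c₀| + ∫⁻ₓ‖m̂ − c₀u‖ + ∫⁻ₓ|Ê − E₀|)`. [folklore] -/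
theorem E4_pathwise {n : ℕ} {γ : ℝ → Config n (Fin 3) T3} (hγ : Measurable γ) {Vb : ℝ}
    (hV : ∀ t i, ‖(γ t i).2‖ ≤ Vb) {k : T3 → T3 → ℝ} (hk : Measurable fun p : T3 × T3 => k p.1 p.2)
    {kb : ℝ} (hk0 : ∀ x y, 0 ≤ k x y) (hkb : ∀ x y, k x y ≤ kb) {T τ : ℝ} (hτ : τ ∈ Ico 0 T)
    {w : ℝ → T3 → V3} (hw : Torus.IsSmoothSpaceTimeOn (Ico 0 T) w) {C : ℝ}
    (hC : ∀ t ∈ Icc 0 τ, ∀ (i j : Fin 3) (x : T3), |Torus.partialDeriv j (fun y => w t y i) x| ≤ C)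
    {c₀ A E₀ : ℝ} {u : V3} (hc₀ : 0 < c₀) (hA0 : 0 ≤ A)
    (hA : ∀ (r E : ℝ) (m : V3), 0 ≤ r → 0 ≤ E → ‖m‖ ^ 2 ≤ 2 * r * E → ∀ i j : Fin 3,
      |m i * m j / r - c₀ * (u i * u j)| ≤ A * (|r - c₀| + ‖m - c₀ • u‖ + |E - E₀|)) :
    ENNReal.ofReal |(∫ t in Ioc 0 τ, ∫ x, ∑ i, ∑ j, empiricalMomentumField (γ t) (k x) i * empiricalMomentumField (γ t) (k x) j / empiricalDensityField (γ t) (k x) * Torus.partialDeriv j (fun y => w t y i) x) - ∫ t in Ioc 0 τ, ∫ x, ∑ i, ∑ j, (c₀ • u) i * (c₀ • u) j / c₀ * Torus.partialDeriv j (fun y => w t y i) x| ≤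
      ∫⁻ t in Ioc 0 τ, ENNReal.ofReal (9 * C * A) * (((∫⁻ x, ENNReal.ofReal |empiricalDensityField (γ t) (k x) - c₀|) + ∫⁻ x, ENNReal.ofReal ‖empiricalMomentumField (γ t) (k x) - c₀ • u‖) + ∫⁻ x, ENNReal.ofReal |empiricalEnergyField (γ t) (k x) - E₀|) := by
  obtain ⟨H, C₁, hHm, -, hHs, hHC⟩ := FluxClosureB4.exists_measurable_fderiv hτ.2 hw
  have abs_sum_sum_le : ∀ {f : Fin 3 → Fin 3 → ℝ} {c : ℝ}, (∀ i j, |f i j| ≤ c) → |∑ i, ∑ j, f i j| ≤ 9 * c :=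
    fun h => ((Finset.abs_sum_le_sum_abs _ _).trans (Finset.sum_le_sum fun i _ =>
      (Finset.abs_sum_le_sum_abs _ _).trans (Finset.sum_le_sum fun j _ => h i j))).trans (by simp; linarith)
  have abs_mul_le_mul : ∀ {a b a' b' : ℝ}, |a| ≤ a' → |b| ≤ b' → |a * b| ≤ a' * b' := fun ha hb => by
    rw [abs_mul]; exact mul_le_mul ha hb (abs_nonneg _) ((abs_nonneg _).trans ha)
  obtain ⟨D, hD⟩ : ∃ D : ℝ × T3 → ℝ, D = fun p => empiricalDensityField (γ p.1) (k p.2) := ⟨_, rfl⟩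
  obtain ⟨M, hM⟩ : ∃ M : ℝ × T3 → V3, M = fun p => empiricalMomentumField (γ p.1) (k p.2) := ⟨_, rfl⟩
  obtain ⟨B, hB⟩ : ∃ B : Fin 3 → Fin 3 → ℝ × T3 → ℝ, B = fun a b p => H p (0, EuclideanSpace.single a 1) b := ⟨_, rfl⟩
  have hγx : Measurable fun p : ℝ × T3 => (γ p.1, p.2) := (hγ.comp measurable_fst).prodMk measurable_snd
  have mD : Measurable D := by
    rw [hD]
    exact Measurable.comp (g := fun q : Config n (Fin 3) T3 × T3 => empiricalDensityField q.1 (k q.2))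
      (f := fun p : ℝ × T3 => (γ p.1, p.2)) (FluxClosureB5.measurable_density (n := n) (K := k) hk) hγx
  have mM : Measurable M := by
    rw [hM]
    exact Measurable.comp (g := fun q : Config n (Fin 3) T3 × T3 => empiricalMomentumField q.1 (k q.2))
      (f := fun p : ℝ × T3 => (γ p.1, p.2)) (FluxClosureB5.measurable_momentum (n := n) (K := k) hk) hγx
  have mMi : ∀ i, Measurable fun p => M p i := fun i => (show Measurable fun v : V3 => v i by fun_prop).comp mM
  have mB : ∀ a b, Measurable (B a b) := fun a b => by
    rw [hB]; exact (show Measurable fun v : V3 => v b by fun_prop).comp (hHm.apply_continuousLinearMap _)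
  have bQ : ∀ p i j, |M p i * M p j / D p| ≤ Vb ^ 2 * kb := fun p i j => by
    have h := FluxClosureB4.boxAtoms_bounds (γ p.1) (hk0 p.2) (hkb p.2) (hV p.1)
    rw [hD, hM]; exact FluxClosureB4.abs_mul_div_le h.1.1 h.1.2 h.2.1 i j
  have bB : ∀ a b (p : ℝ × T3), p.1 ∈ Icc 0 τ → |B a b p| ≤ C₁ := fun a b p hp => by
    have h := (H p).le_of_opNorm_le (hHC p.1 hp p.2) ((0 : ℝ), EuclideanSpace.single a (1 : ℝ))
    rw [show ‖((0 : ℝ), EuclideanSpace.single a (1 : ℝ))‖ = 1 by simp [Prod.norm_def], mul_one] at h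
    rw [hB]; exact le_trans (by simpa using PiLp.norm_apply_le (H p (0, EuclideanSpace.single a 1)) b) h
  have bU : ∀ i j, |(c₀ • u) i * (c₀ • u) j / c₀| ≤ c₀ * ‖u‖ ^ 2 := fun i j => by
    have e : (c₀ • u) i * (c₀ • u) j / c₀ = c₀ * (u i * u j) := by
      rw [PiLp.smul_apply, PiLp.smul_apply, smul_eq_mul, smul_eq_mul]; field_simp
    rw [e, abs_mul, abs_of_pos hc₀, abs_mul, sq]
    refine mul_le_mul_of_nonneg_left (mul_le_mul ?_ ?_ (abs_nonneg _) (norm_nonneg _)) hc₀.le <;>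
      simpa using PiLp.norm_apply_le u _
  have eB : ∀ t ∈ Ico 0 T, ∀ x (a b : Fin 3), Torus.partialDeriv a (fun y => w t y b) x = B a b (t, x) :=
    fun t ht x a b => by rw [hB, hHs t ht x a b]
  obtain ⟨m₁, m₂, m₃⟩ := E4_measurable_dev (n := n) (K := k) hk c₀ E₀ u
  have h9 : 0 ≤ 9 * C * A := by
    have := (abs_nonneg _).trans (hC 0 ⟨le_rfl, hτ.1⟩ 0 0 0); positivity
  have mG : Measurable fun p => ∑ i, ∑ j, M p i * M p j / D p * B j i p := by fun_prop
  have mG' : Measurable fun p => ∑ i, ∑ j, (c₀ • u) i * (c₀ • u) j / c₀ * B j i p := by fun_prop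
  have hb : ∀ t ∈ Ioc 0 τ, ∀ x, ENNReal.ofReal |(∑ i, ∑ j, empiricalMomentumField (γ t) (k x) i *
      empiricalMomentumField (γ t) (k x) j / empiricalDensityField (γ t) (k x) * Torus.partialDeriv j (fun y => w t y i) x) -
      ∑ i, ∑ j, (c₀ • u) i * (c₀ • u) j / c₀ * Torus.partialDeriv j (fun y => w t y i) x| ≤
      ENNReal.ofReal (9 * C * A) * ((ENNReal.ofReal |empiricalDensityField (γ t) (k x) - c₀| +
        ENNReal.ofReal ‖empiricalMomentumField (γ t) (k x) - c₀ • u‖) + ENNReal.ofReal |empiricalEnergyField (γ t) (k x) - E₀|) := by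
    intro t ht x
    obtain ⟨hr, hE, hCS⟩ := E4_boxFields_hyp (γ t) (hk0 x)
    refine (ENNReal.ofReal_le_ofReal (E4_abs_sum_sub_sum_le hc₀ hA0 hA hr hE hCS
      (g := fun i j => Torus.partialDeriv j (fun y => w t y i) x) (fun i j => hC t ⟨ht.1.le, ht.2⟩ i j x))).trans_eq ?_
    rw [ENNReal.ofReal_mul h9, ENNReal.ofReal_add (by positivity) (abs_nonneg _),
      ENNReal.ofReal_add (abs_nonneg _) (norm_nonneg _)]
  refine (E4_ofReal_abs_sub_le hτ.2 mG mG' (fun t ht x => by simp only [eB t ht x, hD, hM]) (fun t ht x => by simp only [eB t ht x])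
    (fun p hp => abs_sum_sum_le fun i j => abs_mul_le_mul (bQ p i j) (bB j i p hp))
    (fun p hp => abs_sum_sum_le fun i j => abs_mul_le_mul (bU i j) (bB j i p hp)) hb).trans_eq (lintegral_congr fun t => ?_)
  have n₁ : Measurable fun x => ENNReal.ofReal |empiricalDensityField (γ t) (k x) - c₀| :=
    Measurable.comp (g := fun q : Config n (Fin 3) T3 × T3 => ENNReal.ofReal |empiricalDensityField q.1 (k q.2) - c₀|)
      (f := fun x : T3 => (γ t, x)) m₁ measurable_prodMk_left
  have n₂ : Measurable fun x => ENNReal.ofReal ‖empiricalMomentumField (γ t) (k x) - c₀ • u‖ :=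
    Measurable.comp (g := fun q : Config n (Fin 3) T3 × T3 => ENNReal.ofReal ‖empiricalMomentumField q.1 (k q.2) - c₀ • u‖)
      (f := fun x : T3 => (γ t, x)) m₂ measurable_prodMk_left
  have n₁₂ : Measurable fun x => ENNReal.ofReal |empiricalDensityField (γ t) (k x) - c₀| +
      ENNReal.ofReal ‖empiricalMomentumField (γ t) (k x) - c₀ • u‖ := n₁.add n₂
  rw [lintegral_const_mul' _ _ ENNReal.ofReal_ne_top, lintegral_add_left n₁₂, lintegral_add_left n₁]

/-- **Main estimate, generic kernel family.** For jointly measurable kernels `0 ≤ k_N ≤ κ_N`, `c₀ > 0`, uniform-in-time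
bounds `∫⁻ z∫⁻ₓ|ρ̂ − c₀|, ∫⁻ z∫⁻ₓ‖m̂ − c₀u‖, ∫⁻ z∫⁻ₓ|Ê − E₀| ≤ δ_N → 0` under the homogeneous local Gibbs law `P_N`,
`τ ∈ [0,T)`, `w` smooth on `[0,T) × 𝕋³`: the time-integrated convective term converges in `L¹(P_N)` to its constant-field
value (`P_N`-a.e. datum is good; `E4_pathwise`; Tonelli in `(z, t)`, `P_N` s-finite; `≤ 27 C A τ δ_N → 0`). [folklore] -/
theorem E4_tendsto {σ a θ c₀ T E₀ : ℝ} {u : V3}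
    (Φ : (N : ℕ) → HardSphereFlow (Torus.geometry (Fin 3)) (hsDiameter σ N) (N + 1))
    {k : ℕ → T3 → T3 → ℝ} {kb : ℕ → ℝ} (hkm : ∀ N, Measurable fun p : T3 × T3 => k N p.1 p.2)
    (hk0 : ∀ N x y, 0 ≤ k N x y) (hkb : ∀ N x y, k N x y ≤ kb N) (hc₀ : 0 < c₀) {δ : ℕ → ℝ≥0∞}
    (hδ : Tendsto δ atTop (𝓝 0))
    (hbd : ∀ (N : ℕ) (t : ℝ), (∫⁻ z, (∫⁻ x, ENNReal.ofReal |empiricalDensityField ((Φ N).flow t z) (k N x) - c₀|) ∂(localGibbsLaw σ (fun _ => a) (fun _ => u) (fun _ => θ) N (Φ N)) ≤ δ N) ∧ (∫⁻ z, (∫⁻ x, ENNReal.ofReal ‖empiricalMomentumField ((Φ N).flow t z) (k N x) - c₀ • u‖) ∂(localGibbsLaw σ (fun _ => a) (fun _ => u) (fun _ => θ) N (Φ N)) ≤ δ N) ∧ (∫⁻ z, (∫⁻ x, ENNReal.ofReal |empiricalEnergyField ((Φ N).flow t z) (k N x) - E₀|) ∂(localGibbsLaw σ (fun _ => a) (fun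 _ => u) (fun _ => θ) N (Φ N)) ≤ δ N))
    {τ : ℝ} (hτ : τ ∈ Ico 0 T) {w : ℝ → T3 → V3} (hw : Torus.IsSmoothSpaceTimeOn (Ico 0 T) w) :
    Tendsto (fun N : ℕ => ∫⁻ z, ENNReal.ofReal (|(∫ t in Ioc 0 τ, ∫ x, ∑ i, ∑ j, empiricalMomentumField ((Φ N).flow t z) (k N x) i * empiricalMomentumField ((Φ N).flow t z) (k N x) j / empiricalDensityField ((Φ N).flow t z) (k N x) * Torus.partialDeriv j (fun y => w t y i) x) - ∫ t in Ioc 0 τ, ∫ x, ∑ i, ∑ j, (c₀ • u) i * (c₀ • u) j / c₀ * Torus.partialDeriv j (fun y => w t y i) x|) ∂(localGibbsLaw σ (fun _ => a) (fun _ => u) (fun _ => θ) N (Φ N))) atTop (𝓝 0) := by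
  obtain ⟨C, -, hC⟩ := FluxClosureK.exists_forall_abs_partialDeriv_le_slab hτ.2 hw
  obtain ⟨A, hA0, hA⟩ := E4_exists_coeff hc₀ u E₀
  have hKc : ENNReal.ofReal (9 * C * A) * 3 * ENNReal.ofReal τ ≠ ⊤ :=
    ENNReal.mul_ne_top (ENNReal.mul_ne_top ENNReal.ofReal_ne_top (by simp)) ENNReal.ofReal_ne_top
  have hup : Tendsto (fun N => ENNReal.ofReal (9 * C * A) * 3 * ENNReal.ofReal τ * δ N) atTop (𝓝 0) := by
    have h := ENNReal.Tendsto.const_mul hδ (Or.inr hKc)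
    rwa [mul_zero] at h
  refine tendsto_of_tendsto_of_tendsto_of_le_of_le tendsto_const_nhds hup (fun N => zero_le) (fun N => ?_)
  dsimp only
  haveI hTV : SigmaFinite (volume : Measure (T3 × V3)) := inferInstance
  haveI hCfg : SigmaFinite (volume : Measure (Config (N + 1) (Fin 3) T3)) := inferInstance
  haveI : SFinite (localGibbsLaw σ (fun _ => a) (fun _ => u) (fun _ => θ) N (Φ N)) := by
    rw [localGibbsLaw, particleLaw_eq, liouville_eq]; infer_instance
  have hμ : localGibbsLaw σ (fun _ => a) (fun _ => u) (fun _ => θ) N (Φ N) (Φ N).goodᶜ = 0 := by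
    have hac : localGibbsLaw σ (fun _ => a) (fun _ => u) (fun _ => θ) N (Φ N) ≪
        liouville (Torus.geometry (Fin 3)) (N + 1) (hsDiameter σ N) := by
      rw [localGibbsLaw, particleLaw_eq]; exact withDensity_absolutelyContinuous _ _
    exact hac (Φ N).measure_compl_good
  obtain ⟨m₁, m₂, m₃⟩ := E4_measurable_dev (n := N + 1) (K := k N) (hkm N) c₀ E₀ u
  have l₁ : Measurable fun c : Config (N + 1) (Fin 3) T3 => ∫⁻ x, ENNReal.ofReal |empiricalDensityField c (k N x) - c₀| :=
    m₁.lintegral_prod_right'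
  have l₂ : Measurable fun c : Config (N + 1) (Fin 3) T3 => ∫⁻ x, ENNReal.ofReal ‖empiricalMomentumField c (k N x) - c₀ • u‖ :=
    m₂.lintegral_prod_right'
  have l₃ : Measurable fun c : Config (N + 1) (Fin 3) T3 => ∫⁻ x, ENNReal.ofReal |empiricalEnergyField c (k N x) - E₀| :=
    m₃.lintegral_prod_right'
  obtain ⟨g, hg⟩ : ∃ g : Config (N + 1) (Fin 3) T3 → ℝ≥0∞, g = fun c => ENNReal.ofReal (9 * C * A) *
      (((∫⁻ x, ENNReal.ofReal |empiricalDensityField c (k N x) - c₀|) +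
        ∫⁻ x, ENNReal.ofReal ‖empiricalMomentumField c (k N x) - c₀ • u‖) +
        ∫⁻ x, ENNReal.ofReal |empiricalEnergyField c (k N x) - E₀|) := ⟨_, rfl⟩
  have mg : Measurable g := by rw [hg]; exact ((l₁.add l₂).add l₃).const_mul _
  calc _ ≤ ∫⁻ z, (∫⁻ t in Ioc 0 τ, g ((Φ N).flow t z)) ∂(localGibbsLaw σ (fun _ => a) (fun _ => u) (fun _ => θ) N (Φ N)) := by
        refine lintegral_mono_ae ((ae_mem_good_localGibbsLaw σ (fun _ => a) (fun _ => θ) (fun _ => u) N (Φ N)).mono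
          fun z hz => ?_)
        have hγ : Measurable fun t : ℝ => (Φ N).flow t z :=
          (Φ N).measurable_flow_prod_torus.comp ((measurable_const (a := (⟨z, hz⟩ : (Φ N).good))).prodMk measurable_id)
        rw [hg]
        exact E4_pathwise hγ (fun t i => FluxClosureB4.norm_vel_flow_le (Φ N) hz t i) (hkm N) (hk0 N) (hkb N) hτ hw
          hC hc₀ hA0 hA
    _ = ∫⁻ t in Ioc 0 τ, ∫⁻ z, g ((Φ N).flow t z) ∂(localGibbsLaw σ (fun _ => a) (fun _ => u) (fun _ => θ) N (Φ N)) :=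
        lintegral_lintegral_swap (E4_aemeasurable_comp_flow_prod (Φ N) mg hμ _)
    _ ≤ ∫⁻ _t in Ioc 0 τ, ENNReal.ofReal (9 * C * A) * (3 * δ N) := by
        refine lintegral_mono fun t => ?_
        obtain ⟨h1, h2, h3⟩ := hbd N t
        have e₁ : Measurable fun z => ∫⁻ x, ENNReal.ofReal |empiricalDensityField ((Φ N).flow t z) (k N x) - c₀| :=
          l₁.comp ((Φ N).measurable_flow t)
        have e₁₂ : Measurable fun z => (∫⁻ x, ENNReal.ofReal |empiricalDensityField ((Φ N).flow t z) (k N x) - c₀|) +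
            ∫⁻ x, ENNReal.ofReal ‖empiricalMomentumField ((Φ N).flow t z) (k N x) - c₀ • u‖ :=
          e₁.add (l₂.comp ((Φ N).measurable_flow t))
        rw [hg]
        dsimp only
        rw [lintegral_const_mul' _ _ ENNReal.ofReal_ne_top, lintegral_add_left e₁₂, lintegral_add_left e₁]
        exact mul_le_mul' le_rfl ((add_le_add_three h1 h2 h3).trans_eq (by ring))
    _ = ENNReal.ofReal (9 * C * A) * 3 * ENNReal.ofReal τ * δ N := by
        rw [setLIntegral_const, Real.volume_Ioc, sub_zero]; ring

/-- **Registered sub-goal E4 (`homogeneous_convectiveTerm`) of the rung-0 programme of crux `FluxClosure`.** In the crux's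
vocabulary (cube kernel `K`, box fields `Dn, Mm, En` of `Φ_t z` at window `ℓ_N`), under the homogeneous local Gibbs law
`P_N = localGibbsLaw σ a u θ N (Φ N)` (constant profiles): GIVEN `δ_N → 0` bounding, uniformly in `t`, the three fine-scale
deviations `∫⁻ z∫⁻ₓ|Dn − c₀|`, `∫⁻ z∫⁻ₓ‖Mm − c₀u‖`, `∫⁻ z∫⁻ₓ|En − totalEnergyDensity c₀ u θ|`, and `c₀ > 0`, for every
`τ ∈ [0,T)` and every `w` smooth on `[0,T) × 𝕋³` the convective term `∫_0^τ∫ Σ_ij (Mm_i Mm_j / Dn) ∂_jw_i` converges in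
`L¹(P_N)` to `∫_0^τ∫ Σ_ij ((c₀u)_i(c₀u)_j/c₀) ∂_jw_i`: `E4_tendsto` at the cube kernel (`LGFS.measurable_boxK_uncurry`,
`boxK_nonneg`, `boxK_le`). [folklore] -/
theorem homogeneous_convectiveTerm : ∀ (σ a θ c₀ T : ℝ) (u : V3) (Φ : (N : ℕ) → HardSphereFlow (Torus.geometry (Fin 3)) (hsDiameter σ N) (N + 1)) (ℓ : ℕ → ℝ), (∀ N, 0 < ℓ N ∧ ℓ N ≤ 1) → 0 < c₀ → let K := fun (l : ℝ) (x y : T3) => indicator {y' : T3 | ∀ i, ‖y' i - x i‖ < l / 2} (fun _ => (l ^ 3)⁻¹) y; let Dn := fun N t z x => empiricalDensityField ((Φ N).flow t z) (K (ℓ N) x); let Mm := fun N t z x => empiricalMomentumField ((Φ N).flow t z) (K (ℓ N) x); let En := fun N t z x => empiricalEnergyField ((Φ N).flow t z) (K (ℓ N) x); ∀ δ : ℕ → ℝ≥0∞, Tendsto δ atTop (𝓝 0) → (∀ (N : ℕ) (t : ℝ), (∫⁻ z, (∫⁻ x, ENNReal.ofReal |Dn N t z x - c₀|) ∂(localGibbsLaw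 σ (fun _ => a) (fun _ => u) (fun _ => θ) N (Φ N)) ≤ δ N) ∧ (∫⁻ z, (∫⁻ x, ENNReal.ofReal ‖Mm N t z x - c₀ • u‖) ∂(localGibbsLaw σ (fun _ => a) (fun _ => u) (fun _ => θ) N (Φ N)) ≤ δ N) ∧ (∫⁻ z, (∫⁻ x, ENNReal.ofReal |En N t z x - totalEnergyDensity c₀ u θ|) ∂(localGibbsLaw σ (fun _ => a) (fun _ => u) (fun _ => θ) N (Φ N)) ≤ δ N)) → ∀ τ ∈ Ico 0 T, ∀ w : ℝ → T3 → V3, Torus.IsSmoothSpaceTimeOn (Ico 0 T) w → Tendsto (fun N : ℕ => ∫⁻ z, ENNReal.ofReal (|(∫ t in Ioc 0 τ, ∫ x, ∑ i, ∑ j, Mm N t z x i * Mm N t z x j / Dn N t z x * Torus.partialDeriv j (fun y => w t y i) x) - ∫ t in Ioc 0 τ, ∫ x, ∑ i, ∑ j, (c₀ • u) i * (c₀ • u) j / c₀ * Torus.partialDeriv j (fun y => w t y i) x|) ∂(localGibbsLaw σ (fun _ => a) (fun _ => u) (fun _ => θ) N (Φ N))) atTop (𝓝 0) := by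
  intro σ a θ c₀ T u Φ ℓ hℓ hc₀
  dsimp only
  intro δ hδ hbd τ hτ w hw
  exact E4_tendsto (E₀ := totalEnergyDensity c₀ u θ) Φ
    (k := fun N x y => indicator {y' : T3 | ∀ i, ‖y' i - x i‖ < ℓ N / 2} (fun _ => (ℓ N ^ 3)⁻¹) y)
    (kb := fun N => (ℓ N ^ 3)⁻¹) (fun N => LGFS.measurable_boxK_uncurry (ℓ N))
    (fun N x y => LGFS.boxK_nonneg (hℓ N).1.le x y) (fun N x y => LGFS.boxK_le (hℓ N).1.le x y) hc₀ hδ hbd hτ hw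

end E4
end FluxClosureEq
end Summit.AtomisticToContinuum.HydrodynamicLimit.Theorems
end
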